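import Literature.MathematicalPhysics.QuantumFieldTheory.Balaban1983to89.Beta.HessKerRate
import Summits.QuantumFields.BalabanUV.Beta.FP.TorusCompositeObjects
import Summits.QuantumFields.BalabanUV.Beta.NVertexParities
import Summits.QuantumFields.BalabanUV.Beta.NVertexEvenBorderTorus

/-!
# `BalabanUV.Beta.FP.TowerSigmaLegLetters` — road «FP», binder row D1, ROUTE T (β1): **THE σ-LETTERS OF THE END WRAPPER v9** (`g47/SPEC-60.md`; an2 g72 A-1
# l.68176 + PART 35 `FP/NestedConstraintScaling`: the (L2′) N leg carries the KKT fibre scaling `σ_n = 1 ⊕ s_n⁻¹`, `s_n = ∏_{ℓ<n+2} stepScale 3 Lc ℓ`)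

WHY.  The END wrapper v8 (`FP/StepRecursionFeedNestedNamedG`) displays its (S3-1) N leg `hLN` at the composite chart `AN (Roots.ctr Lc) (n+1)`; by value (Engine C
K2L-C gate G3) and by kernel (PART 35 §4–§5) the nested one-shot system's inverse reads that chart through the fibre scaling `σ_n` (field slots `1`, multiplier
slots `s_n⁻¹`).  v9 (`FP/StepRecursionFeedNestedNamedH`) therefore feeds the named tower law `TowerKernelLawNamedC.hessKer_law_tower_namedC` with the chart
`scaleK σ σ AN` and the vertex families `scaleK σ′ σ′ ∘ (VN, WN)` (`σ·σ′ = 1`), and returns to `hessKer AN VN WN` by Literature `HessKerRate.hessKer_scaleK`.  THIS FILE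
is the small generic bookkeeping that transport needs, nothing else:
* §1 `scaleK` under the torus periodisation `perF` (`KernelPeriodisationFib.perF_scaleK_apply`, by name), the localisation `dper` and the block shift `shiftK`
  (entrywise scalars; `dper_scaleK`, `perF_dper_scaleK_apply`, `shiftK_scaleK`), the block readings (`submatrix_perF_dper_scaleK_of_one ∕ _of_left`: a block whose row fibres carry
  the scalar `t` and whose column fibres carry `1` is `t •` the unscaled block) and the WINDING TRACE (`trace_perF_scaleK_mul_perF_dper_scaleK`: the periodised
  tadpole trace is invariant under `A ↦ σAσ`, `W ↦ σ′Wσ′`, `σσ′ = 1` — cyclicity, finite sums);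
* §2 the two scalings `σ = 1 ⊕ s⁻¹`, `σ′ = 1 ⊕ s` of `Fib d`: sup bounds `|σ| ≤ 1`, `|σ′| ≤ s` for `1 ≤ s` (the `Decays ∕ BiLoc` constants of `HessKerRate.decays_scaleK ∕
  biLoc_scaleK`), and `1 ≤ ∏ stepScale`;
* §3 THE TWO BORDER BRIDGES between pin sets `P, P′ : Pins` whose border pins differ by a scalar (`P′.cVH (j+1) = t·P.cVH (j+1)`, resp. `P′.cB (j+1) = t·P.cB (j+1)`;
  every other pin arbitrary): the multiplier rows of the periodised N-vertex (an2 PART 12 `NVertexParities.perF_dper_VN_inr`: `= cVH • (pin-free)`) and the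
  multiplier–field block of the periodised wound even N-family (an2 PART 20 `NVertexEvenBorderTorus.perF_dper_wound_WN_evenHalf_inr_inl_eq_sum`: `= −cB · (pin-free)`)
  scale by `t` — so v8's landed 𝔔-row theorems (`TowerN1RowsFamily.hQN1_family_of_road_data`, `TowerQN2RowFamily.hQN2_family_of_lock`), applied at the pin set
  `P‡ = (Pn with cVH, cB ↦ s_n·cVH, s_n·cB)`, deliver the rows of the σ′-conjugated families at the UNIT border locks;
* §4 three lines of linear algebra on the road's `(r • x + y)`-linearity letters (`map_smul_of_lin`, `lin_comp_smul`, `lin_of_lin_comp_smul`) and the RESCALED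
  STOREY COLUMNS (`hb_rescale_of_sigma`: if the storey columns `hbF` display the lower storeys through `scaleK σ σ AN`, `σ = 1 ⊕ t⁻¹`, then `v ↦ hbF k (t • v)` displays them
  through `AN` — `TowerHLinkRows`' shape VERBATIM), by which every direction-dependent letter of v9 read at the rescaled source `t • v` satisfies v8's displayed pins.

[folklore] `tsum_mul_left ∕ Finset.mul_sum ∕ Matrix.trace` bookkeeping BY NAME over the cell's own objects; no `def`, no `instance`, nothing cited as a hypothesis;
nothing of Bałaban's asserted, valued or discharged; 0 estimates; 0∕4 row-D1 binders (hW ∕ hR ∕ D1Tel ∕ D1Rep); ROOT M‴ p325680 ∕ P5c ∕ D6 untouched; (L2′) NOT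
discharged (v9 DISPLAYS the σ-leg); NOT (C1), NOT (T-ID), NOT SDF, NOT D1, NEVER «G-an2-4 closed», NOT BetaPertH, NOT continuum, NOT Clay.
HONEST DEPENDENCY (page 1, mandatory): continuum YM on T⁴ ⇐ BetaPertH ∧ nine spine estimates (0/9 proved); BetaPertH ⇐ (D1) ∧ (D4) ∧ CAP+tail;
G-an2-4 gates asym, D1 and NE2/3/4.  HONEST FRAMING (cell contract, verbatim): «discharging `BetaPertH` makes Bałaban's UV stability UNCONDITIONAL —
a real constructive-QFT result; it is NOT the continuum limit and NOT the Clay problem.»  ABSOLUTE RULE (cell charter, verbatim): «No internally-minted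
statement may enter as a cited fact. Every hypothesis is either kernel-proved in this package or a verbatim quotation of a PUBLISHED theorem with page
reference. The manuscript(s) under audit are NOT citable for their own disputed steps — they are the thing under adjudication; programme-internal
(2001/route/tribunal) claims are never citable.»  Road «FP» OWNER, b2b-balaban-beta-d1-p3 gen 48, 2026-08-28.  No existing file touched.
-/

noncomputable section

open scoped BigOperators Matrix

namespace Summit.QuantumFields.BalabanUV.Beta.FP.TowerSigmaLegLetters

open Matrix Finset
open Literature.MathematicalPhysics.QuantumFieldTheory.Balaban1983to89
open Literature.MathematicalPhysics.QuantumFieldTheory.Balaban1983to89.Beta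
open Literature.MathematicalPhysics.QuantumFieldTheory.Balaban1983to89.Beta.HessKerRate (scaleK scaleK_apply)
open B4TorusKernel.MultiPeriod (translate)
open B6Lemma24Torus (pbox)
open AffineAveraging (Site)
open OneStepResolventKernel (Fib KInv)
open ExpKernelCalculus (MKer shiftK)
open BalabanStepJets (lamCoeffOf)
open Summit.QuantumFields.BalabanUV.Beta.BorderedHessian (stepScale stepScale_pos sgnK)
open Summit.QuantumFields.BalabanUV.Beta.TameKernelCalculus (trK)
open Summit.QuantumFields.BalabanUV.Beta.SymAveragingHessianCounts (symLinKerAt)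
open Summit.QuantumFields.BalabanUV.Beta.CompositeVertexKernelRec (compLinKer)
open Summit.QuantumFields.BalabanUV.Beta.FP.KernelPeriodisationFib (Idx perF perF_apply perZ_apply perF_scaleK_apply)
open Summit.QuantumFields.BalabanUV.Beta.FP.KernelPeriodisationFibLoc (dper dper_apply)
open Summit.QuantumFields.BalabanUV.Beta.FP.TorusGaugeCovariancePairing (wrapPt)
open Summit.QuantumFields.BalabanUV.Beta.FP.TorusCompositeObjects (towerTorus)
open Summit.QuantumFields.BalabanUV.Beta.CompositeOneShotJetData (Roots Pins AN VN WN)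
open Summit.QuantumFields.BalabanUV.Beta.NVertexParities (perF_dper_VN_inr)
open Summit.QuantumFields.BalabanUV.Beta.NVertexEvenBorderTorus (perF_dper_wound_WN_evenHalf_inr_inl_eq_sum)

/-! ## §1 `scaleK` under `perF`, `dper`, `shiftK`; block readings; the winding trace -/

section ScaleK

variable {d : ℕ} {F : Type*}

/-- [folklore] the localisation commutes with a fibre scaling: `dper M (uVv) = u (dper M V) v` (the twin of `FP/PackedLegFullIndex.dper_scaleK`, which lives outside this
file's import closure; the entrywise `perF` form is `KernelPeriodisationFib.perF_scaleK_apply`, used BY NAME below). -/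
theorem dper_scaleK (M : Fin (d + 1) → ℕ) (u v : F → ℝ) (V : MKer (d + 1) F) : dper M (scaleK u v V) = scaleK u v (dper M V) := by
  funext x y a b
  simp only [dper_apply, scaleK_apply]
  rw [tsum_mul_right, tsum_mul_left]

/-- [folklore] both at once: `perF M (dper M (uVv)) p q = u p.2 · perF M (dper M V) p q · v q.2`. -/
theorem perF_dper_scaleK_apply (M : Fin (d + 1) → ℕ) (u v : F → ℝ) (V : MKer (d + 1) F) (p q : Idx M F) :
    perF M (dper M (scaleK u v V)) p q = u p.2 * perF M (dper M V) p q * v q.2 := by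
  rw [dper_scaleK, perF_scaleK_apply]

/-- [folklore] the block shift commutes with a fibre scaling (`rfl`). -/
theorem shiftK_scaleK (t : Site (d + 1)) (u v : F → ℝ) (K : MKer (d + 1) F) : shiftK t (scaleK u v K) = scaleK u v (shiftK t K) := rfl

/-- [folklore] **a block whose row AND column fibres carry the scalar `1` is unchanged** (the `ff` readings `hHN₁ ∕ hHN₂` of v9: `σ′(inl ·) = 1`). -/
theorem submatrix_perF_dper_scaleK_of_one {ι κ : Type*} (M : Fin (d + 1) → ℕ) (u v : F → ℝ) (V : MKer (d + 1) F) (f : ι → Idx M F) (g : κ → Idx M F)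
    (hu : ∀ a, u (f a).2 = 1) (hv : ∀ b, v (g b).2 = 1) :
    (perF M (dper M (scaleK u v V))).submatrix f g = (perF M (dper M V)).submatrix f g := by
  ext a b
  simp only [Matrix.submatrix_apply, perF_dper_scaleK_apply, hu, hv, one_mul, mul_one]

/-- [folklore] **a block whose row fibres carry `t` and whose column fibres carry `1` is `t •` the unscaled block** (the `(fN, ♭)` readings `hQN₁ ∕ hQN₂` of v9:
`σ′(inr ·) = s_n`). -/
theorem submatrix_perF_dper_scaleK_of_left {ι κ : Type*} (M : Fin (d + 1) → ℕ) (u v : F → ℝ) (V : MKer (d + 1) F) (f : ι → Idx M F) (g : κ → Idx M F)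
    (t : ℝ) (hu : ∀ a, u (f a).2 = t) (hv : ∀ b, v (g b).2 = 1) :
    (perF M (dper M (scaleK u v V))).submatrix f g = t • (perF M (dper M V)).submatrix f g := by
  ext a b
  simp only [Matrix.submatrix_apply, Matrix.smul_apply, smul_eq_mul, perF_dper_scaleK_apply, hu, hv, mul_one]

/-- [folklore] the `ff` block under the ONE-SHOT FIBRE scalings `1 ⊕ t`, `1 ⊕ t′` (no side condition; the END wrapper's `hHN₁ ∕ hHN₂` readings). -/
theorem submatrix_ff_perF_dper_fibScale {d' : ℕ} (M : Fin (d + 1) → ℕ) (t t' : ℝ) (V : MKer (d + 1) (Fib d')) :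
    (perF M (dper M (scaleK (Sum.elim (fun _ : Fin (d' + 1) => (1 : ℝ)) (fun _ : Fin (d' + 1) => t))
        (Sum.elim (fun _ : Fin (d' + 1) => (1 : ℝ)) (fun _ : Fin (d' + 1) => t')) V))).submatrix
        (fun b : ↥(pbox M) × Fin (d' + 1) => ((b.1, Sum.inl b.2) : Idx M (Fib d'))) (fun b : ↥(pbox M) × Fin (d' + 1) => ((b.1, Sum.inl b.2) : Idx M (Fib d')))
      = (perF M (dper M V)).submatrix (fun b : ↥(pbox M) × Fin (d' + 1) => ((b.1, Sum.inl b.2) : Idx M (Fib d')))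
          (fun b : ↥(pbox M) × Fin (d' + 1) => ((b.1, Sum.inl b.2) : Idx M (Fib d'))) :=
  submatrix_perF_dper_scaleK_of_one M _ _ V _ _ (fun _ => rfl) (fun _ => rfl)

/-- [folklore] a block with rows on an index map landing in multiplier fibres and `ff` columns, under the one-shot fibre scaling `1 ⊕ t` on both sides, is `t •` the unscaled
block (no side condition beyond the landing; the END wrapper's `hQN₁ ∕ hQN₂` readings). -/
theorem submatrix_perF_dper_fibScale_of_inr {d' : ℕ} (M : Fin (d + 1) → ℕ) (t : ℝ) (V : MKer (d + 1) (Fib d')) {ι : Type*} (f : ι → Idx M (Fib d'))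
    (hf : ∀ a : ι, ∃ m : Fin (d' + 1), (f a).2 = Sum.inr m) :
    (perF M (dper M (scaleK (Sum.elim (fun _ : Fin (d' + 1) => (1 : ℝ)) (fun _ : Fin (d' + 1) => t))
        (Sum.elim (fun _ : Fin (d' + 1) => (1 : ℝ)) (fun _ : Fin (d' + 1) => t)) V))).submatrix f
        (fun b : ↥(pbox M) × Fin (d' + 1) => ((b.1, Sum.inl b.2) : Idx M (Fib d')))
      = t • (perF M (dper M V)).submatrix f (fun b : ↥(pbox M) × Fin (d' + 1) => ((b.1, Sum.inl b.2) : Idx M (Fib d'))) :=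
  submatrix_perF_dper_scaleK_of_left M _ _ V f _ t (fun a => by obtain ⟨m, hm⟩ := hf a; rw [hm]; rfl) (fun _ => rfl)

/-- [folklore] **THE WINDING TRACE IS UNITS-INVARIANT**: `tr (perF M (uAu) · perF M (dper M (u′Wu′))) = tr (perF M A · perF M (dper M W))` for `u·u′ = 1`
(finite double sum; the two scalars at each index cancel). -/
theorem trace_perF_scaleK_mul_perF_dper_scaleK [Fintype F] (M : Fin (d + 1) → ℕ) {u u' : F → ℝ} (h : ∀ a, u a * u' a = 1) (A W : MKer (d + 1) F) :
    Matrix.trace (perF M (scaleK u u A) * perF M (dper M (scaleK u' u' W))) = Matrix.trace (perF M A * perF M (dper M W)) := by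
  simp only [Matrix.trace, Matrix.diag, Matrix.mul_apply, perF_scaleK_apply, perF_dper_scaleK_apply]
  refine Finset.sum_congr rfl fun p _ => Finset.sum_congr rfl fun q _ => ?_
  have hp := h p.2
  have hq := h q.2
  calc u p.2 * perF M A p q * u q.2 * (u' q.2 * perF M (dper M W) q p * u' p.2)
      = (u p.2 * u' p.2) * (u q.2 * u' q.2) * (perF M A p q * perF M (dper M W) q p) := by ring
    _ = perF M A p q * perF M (dper M W) q p := by rw [hp, hq, one_mul, one_mul]

end ScaleK

/-! ## §2 The one-shot fibre scalings `σ = 1 ⊕ s⁻¹`, `σ′ = 1 ⊕ s` -/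

section Sigma

variable {d : ℕ}

/-- [folklore] `|σ a| ≤ 1` for `σ = 1 ⊕ s⁻¹`, `1 ≤ s`. -/
theorem abs_fibSigma_le {s : ℝ} (hs : 1 ≤ s) (a : Fib d) :
    |Sum.elim (fun _ : Fin (d + 1) => (1 : ℝ)) (fun _ : Fin (d + 1) => s⁻¹) a| ≤ 1 := by
  rcases a with a | a
  · simp
  · simp only [Sum.elim_inr]
    rw [abs_of_pos (inv_pos.mpr (lt_of_lt_of_le one_pos hs))]
    exact inv_le_one_of_one_le₀ hs

/-- [folklore] `|σ′ a| ≤ s` for `σ′ = 1 ⊕ s`, `1 ≤ s`. -/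
theorem abs_fibSigma'_le {s : ℝ} (hs : 1 ≤ s) (a : Fib d) :
    |Sum.elim (fun _ : Fin (d + 1) => (1 : ℝ)) (fun _ : Fin (d + 1) => s) a| ≤ s := by
  rcases a with a | a
  · simp only [Sum.elim_inl, abs_one]; exact hs
  · simp only [Sum.elim_inr]; rw [abs_of_pos (lt_of_lt_of_le one_pos hs)]

/-- [folklore] `1 ≤ stepScale d Lc j` (`Lc ≥ 1`). -/
theorem one_le_stepScale (Lc : ℕ) [NeZero Lc] (j : ℕ) : 1 ≤ stepScale d Lc j := by
  show (1 : ℝ) ≤ ((Lc : ℝ) ^ j) ^ (d + 2)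
  have hL : (1 : ℝ) ≤ Lc := by exact_mod_cast Nat.one_le_iff_ne_zero.mpr (NeZero.ne Lc)
  exact one_le_pow₀ (one_le_pow₀ hL)

/-- [folklore] `1 ≤ ∏ ℓ ∈ range m, stepScale d Lc ℓ` — in particular `1 ≤ s_n`. -/
theorem one_le_prod_stepScale (Lc : ℕ) [NeZero Lc] (m : ℕ) : 1 ≤ ∏ ℓ ∈ range m, stepScale d Lc ℓ := by
  induction m with
  | zero => simp
  | succ m ih =>
    rw [Finset.prod_range_succ]
    exact one_le_mul_of_one_le_of_one_le ih (one_le_stepScale Lc m)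

end Sigma

/-! ## §3 The border bridges between two pin sets -/

section Bridges

variable {Lc : ℕ} [NeZero Lc] (R : Roots Lc) (P P' : Pins) (j : ℕ) (M : Fin (3 + 1) → ℕ)

/-- [folklore] **multiplier rows of the periodised N-vertex scale with the border pin**: if `P′.cVH (j+1) = t · P.cVH (j+1)` (all other pins arbitrary), then
`perF M (dper M (VN R P′ j μ y)) (p, inr m) (q, b) = t · perF M (dper M (VN R P j μ y)) (p, inr m) (q, b)` (an2 PART 12 `perF_dper_VN_inr`: both sides are
`cVH ·` the same pin-free periodised border vertex). -/
theorem perF_dper_VN_inr_of_cVH {t : ℝ} (hP : P'.cVH (j + 1) = t * P.cVH (j + 1)) (μ : Fin (3 + 1)) (y : Site (3 + 1))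
    (p q : ↥(pbox M)) (m : Fin (3 + 1)) (b : Fib 3) :
    perF M (dper M (VN R P' j μ y)) (p, Sum.inr m) (q, b) = t * perF M (dper M (VN R P j μ y)) (p, Sum.inr m) (q, b) := by
  rw [perF_dper_VN_inr, perF_dper_VN_inr, hP, mul_assoc]

/-- [folklore] the same as a block on an index map landing in multiplier fibres (the `hQN₁` reading): `(…VN R P′…).submatrix f g = t • (…VN R P…).submatrix f g`. -/
theorem submatrix_perF_dper_VN_of_cVH {t : ℝ} (hP : P'.cVH (j + 1) = t * P.cVH (j + 1)) {ι κ : Type*} (f : ι → Idx M (Fib 3))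
    (hf : ∀ a : ι, ∃ m : Fin (3 + 1), (f a).2 = Sum.inr m) (g : κ → Idx M (Fib 3)) (μ : Fin (3 + 1)) (y : Site (3 + 1)) :
    (perF M (dper M (VN R P' j μ y))).submatrix f g = t • (perF M (dper M (VN R P j μ y))).submatrix f g := by
  ext a b
  obtain ⟨m, hm⟩ := hf a
  have ha : f a = ((f a).1, Sum.inr m) := Prod.ext rfl hm
  have hb : g b = ((g b).1, (g b).2) := rfl
  simp only [Matrix.submatrix_apply, Matrix.smul_apply, smul_eq_mul]
  rw [ha, hb]
  exact perF_dper_VN_inr_of_cVH R P P' j M hP μ y _ _ m _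

variable [∀ μ, NeZero (M μ)]

/-- [folklore] **the multiplier–field block of the periodised WOUND EVEN N-family scales with the border pin `cB`**: if `P′.cB (j+1) = t · P.cB (j+1)` (other pins
arbitrary) then, on a box `M = Lc^(j+1)·M′`, the `(inr, inl)` entries of the periodised wound even families of `P′` and `P` differ by the factor `t`
(an2 PART 20 `perF_dper_wound_WN_evenHalf_inr_inl_eq_sum`: both are `−cB ·` the same pin-free double sum). -/
theorem perF_dper_woundEven_inr_inl_of_cB {M' : Fin (3 + 1) → ℕ} (hM : ∀ i, M i = Lc ^ (j + 1) * M' i) {t : ℝ} (hP : P'.cB (j + 1) = t * P.cB (j + 1))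
    (μ : Fin (3 + 1)) (y : Site (3 + 1)) (ν : Fin (3 + 1)) (y' : Site (3 + 1)) (p q : ↥(pbox M)) (m₁ β : Fin (3 + 1)) :
    perF M (dper M (fun x w a b => ∑' e : Site (3 + 1),
        ((1 / 2 : ℝ) • (WN R P' j μ y ν (translate M' y' e) + sgnK (trK (WN R P' j μ y ν (translate M' y' e))))) x w a b)) (p, Sum.inr m₁) (q, Sum.inl β)
      = t * perF M (dper M (fun x w a b => ∑' e : Site (3 + 1),
        ((1 / 2 : ℝ) • (WN R P j μ y ν (translate M' y' e) + sgnK (trK (WN R P j μ y ν (translate M' y' e))))) x w a b)) (p, Sum.inr m₁) (q, Sum.inl β) := by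
  rw [perF_dper_wound_WN_evenHalf_inr_inl_eq_sum R P' j M hM, perF_dper_wound_WN_evenHalf_inr_inl_eq_sum R P j M hM, hP]
  ring

/-- [folklore] the same as the `(fN, ♭)` block (the `hQN₂` reading), `fN` landing in multiplier fibres. -/
theorem submatrix_perF_dper_woundEven_of_cB {M' : Fin (3 + 1) → ℕ} (hM : ∀ i, M i = Lc ^ (j + 1) * M' i) {t : ℝ} (hP : P'.cB (j + 1) = t * P.cB (j + 1))
    {ι : Type*} (f : ι → Idx M (Fib 3)) (hf : ∀ a : ι, ∃ m : Fin (3 + 1), (f a).2 = Sum.inr m)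
    (μ : Fin (3 + 1)) (y : Site (3 + 1)) (ν : Fin (3 + 1)) (y' : Site (3 + 1)) :
    (perF M (dper M (fun x w a b => ∑' e : Site (3 + 1),
        ((1 / 2 : ℝ) • (WN R P' j μ y ν (translate M' y' e) + sgnK (trK (WN R P' j μ y ν (translate M' y' e))))) x w a b))).submatrix f
          (fun b : ↥(pbox M) × Fin (3 + 1) => ((b.1, Sum.inl b.2) : Idx M (Fib 3)))
      = t • (perF M (dper M (fun x w a b => ∑' e : Site (3 + 1),
        ((1 / 2 : ℝ) • (WN R P j μ y ν (translate M' y' e) + sgnK (trK (WN R P j μ y ν (translate M' y' e))))) x w a b))).submatrix f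
          (fun b : ↥(pbox M) × Fin (3 + 1) => ((b.1, Sum.inl b.2) : Idx M (Fib 3))) := by
  ext a b
  obtain ⟨m, hm⟩ := hf a
  have ha : f a = ((f a).1, Sum.inr m) := Prod.ext rfl hm
  simp only [Matrix.submatrix_apply, Matrix.smul_apply, smul_eq_mul]
  rw [ha]
  exact perF_dper_woundEven_inr_inl_of_cB R P P' j M hM hP μ y ν y' _ _ m b.2

end Bridges

/-! ## §4 Linearity letters at a rescaled source; the rescaled storey columns -/

section Lin

variable {V W : Type*} [AddCommGroup V] [Module ℝ V] [AddCommGroup W] [Module ℝ W]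

/-- [folklore] an `(r • x + y)`-linear map kills `0`. -/
theorem map_zero_of_lin (f : V → W) (hf : ∀ (r : ℝ) (x y : V), f (r • x + y) = r • f x + f y) : f 0 = 0 := by
  have h := hf 1 0 0
  rw [smul_zero, zero_add, one_smul] at h
  have h2 : f 0 + f 0 = f 0 + 0 := by rw [add_zero]; exact h.symm
  exact add_left_cancel h2

/-- [folklore] … and is homogeneous: `f (t • x) = t • f x` (cf. `TowerHN1Row.map_smul_of_linear`, stated there for the road's column letters). -/
theorem map_smul_of_lin (f : V → W) (hf : ∀ (r : ℝ) (x y : V), f (r • x + y) = r • f x + f y) (t : ℝ) (x : V) : f (t • x) = t • f x := by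
  have h := hf t x 0
  rwa [add_zero, map_zero_of_lin f hf, add_zero] at h

/-- [folklore] **the letter read at the rescaled source `t • v` is again `(r • x + y)`-linear.** -/
theorem lin_comp_smul (f : V → W) (hf : ∀ (r : ℝ) (x y : V), f (r • x + y) = r • f x + f y) (t : ℝ) :
    ∀ (r : ℝ) (x y : V), f (t • (r • x + y)) = r • f (t • x) + f (t • y) := by
  intro r x y
  rw [smul_add, smul_comm t r x]
  exact hf r (t • x) (t • y)

/-- [folklore] conversely, if `v ↦ f (t • v)` is `(r • x + y)`-linear and `t ≠ 0`, so is `f`. -/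
theorem lin_of_lin_comp_smul (f : V → W) {t : ℝ} (ht : t ≠ 0) (h : ∀ (r : ℝ) (x y : V), f (t • (r • x + y)) = r • f (t • x) + f (t • y)) :
    ∀ (r : ℝ) (x y : V), f (r • x + y) = r • f x + f y := by
  intro r x y
  have h' := h r (t⁻¹ • x) (t⁻¹ • y)
  rw [smul_add, smul_comm t r, smul_inv_smul₀ ht, smul_inv_smul₀ ht] at h'
  exact h'

end Lin

section Storeys

variable {Lc : ℕ} [NeZero Lc] (R : Roots Lc) (n : ℕ) (M : Fin (3 + 1) → ℕ) [∀ μ, NeZero (M μ)]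
variable {κ : Type*} [Fintype κ] (yN : κ → Site (3 + 1)) (μN : κ → Fin (3 + 1))
  (hv : (κ → ℝ) → (↥(pbox (towerTorus Lc (B5Prop11Plancherel.fine Lc M) (n + 1))) × Fin (3 + 1) → ℝ))
  (hbF : (k : ℕ) → (κ → ℝ) → (↥(pbox (towerTorus Lc (B5Prop11Plancherel.fine Lc M) k)) × Fin (3 + 1) → ℝ)) {t : ℝ} (ht : t ≠ 0)
  (hhbσ : ∀ (k : ℕ) (v : κ → ℝ) (ā : ↥(pbox (towerTorus Lc (B5Prop11Plancherel.fine Lc M) k)) × Fin (3 + 1)), hbF k v ā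
    = if k = n + 1 then hv v (wrapPt (towerTorus Lc (B5Prop11Plancherel.fine Lc M) (n + 1)) (ā.1 : Site (3 + 1)), ā.2)
      else ∑ y₀ : ↥(pbox (towerTorus Lc M k)), (if (ā.1 : Site (3 + 1)) = (Lc : ℤ) • (y₀ : Site (3 + 1)) then
        ∑ a : κ, v a * ∑' nn : Site (3 + 1), ∑ ν : Fin (3 + 1), ∑' w : Site (3 + 1),
          (∑ κ' : Fin (3 + 1), ∑' u' : Site (3 + 1),
              scaleK (Sum.elim (fun _ : Fin (3 + 1) => (1 : ℝ)) (fun _ : Fin (3 + 1) => t⁻¹)) (Sum.elim (fun _ : Fin (3 + 1) => (1 : ℝ)) (fun _ : Fin (3 + 1) => t⁻¹))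
                  (AN R (n + 1)) u' (((Lc ^ (n + 1 + 1) : ℕ) : ℤ) • yN a) (Sum.inl κ') (Sum.inr (μN a))
                * lamCoeffOf (KInv (N := Lc ^ (n + 1 + 1)) (d := 3)) (Lc ^ (n + 1 + 1)) ν w κ' u')
            * compLinKer (fun _ => symLinKerAt (AffineAveraging.toSite R.r) Lc) Lc k (ā.2, translate (towerTorus Lc M k) (y₀ : Site (3 + 1)) nn) (ν, w)
        else 0))

include ht hhbσ in
/-- [folklore] **`hb_rescale_of_sigma` — THE STOREY COLUMNS AT THE RESCALED SOURCE DISPLAY THE UNIT CHART**: if `hbF` displays its lower storeys through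
`scaleK σ σ AN`, `σ = 1 ⊕ t⁻¹` (v9's `hhbe`), then `v ↦ hbF k (t • v)` displays them through `AN` — `TowerHLinkRows`' binder `hhbF` VERBATIM with
`hv ↦ (v ↦ hv (t • v))` (the `(inl, inr)` entry of `σAσ` is `t⁻¹ ·` that of `A`; the source weight `t · v a` cancels it). -/
theorem hb_rescale_of_sigma (k : ℕ) (v : κ → ℝ) (ā : ↥(pbox (towerTorus Lc (B5Prop11Plancherel.fine Lc M) k)) × Fin (3 + 1)) :
    hbF k (t • v) ā
    = if k = n + 1 then hv (t • v) (wrapPt (towerTorus Lc (B5Prop11Plancherel.fine Lc M) (n + 1)) (ā.1 : Site (3 + 1)), ā.2)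
      else ∑ y₀ : ↥(pbox (towerTorus Lc M k)), (if (ā.1 : Site (3 + 1)) = (Lc : ℤ) • (y₀ : Site (3 + 1)) then
        ∑ a : κ, v a * ∑' nn : Site (3 + 1), ∑ ν : Fin (3 + 1), ∑' w : Site (3 + 1),
          (∑ κ' : Fin (3 + 1), ∑' u' : Site (3 + 1),
              AN R (n + 1) u' (((Lc ^ (n + 1 + 1) : ℕ) : ℤ) • yN a) (Sum.inl κ') (Sum.inr (μN a))
                * lamCoeffOf (KInv (N := Lc ^ (n + 1 + 1)) (d := 3)) (Lc ^ (n + 1 + 1)) ν w κ' u')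
            * compLinKer (fun _ => symLinKerAt (AffineAveraging.toSite R.r) Lc) Lc k (ā.2, translate (towerTorus Lc M k) (y₀ : Site (3 + 1)) nn) (ν, w)
        else 0) := by
  rw [hhbσ]
  by_cases hk : k = n + 1
  · rw [if_pos hk, if_pos hk]
  · rw [if_neg hk, if_neg hk]
    refine Finset.sum_congr rfl fun y₀ _ => ?_
    split_ifs
    · refine Finset.sum_congr rfl fun a _ => ?_
      have e : (∑' nn : Site (3 + 1), ∑ ν : Fin (3 + 1), ∑' w : Site (3 + 1),
          (∑ κ' : Fin (3 + 1), ∑' u' : Site (3 + 1),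
              scaleK (Sum.elim (fun _ : Fin (3 + 1) => (1 : ℝ)) (fun _ : Fin (3 + 1) => t⁻¹)) (Sum.elim (fun _ : Fin (3 + 1) => (1 : ℝ)) (fun _ : Fin (3 + 1) => t⁻¹))
                  (AN R (n + 1)) u' (((Lc ^ (n + 1 + 1) : ℕ) : ℤ) • yN a) (Sum.inl κ') (Sum.inr (μN a))
                * lamCoeffOf (KInv (N := Lc ^ (n + 1 + 1)) (d := 3)) (Lc ^ (n + 1 + 1)) ν w κ' u')
            * compLinKer (fun _ => symLinKerAt (AffineAveraging.toSite R.r) Lc) Lc k (ā.2, translate (towerTorus Lc M k) (y₀ : Site (3 + 1)) nn) (ν, w))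
        = t⁻¹ * (∑' nn : Site (3 + 1), ∑ ν : Fin (3 + 1), ∑' w : Site (3 + 1),
          (∑ κ' : Fin (3 + 1), ∑' u' : Site (3 + 1),
              AN R (n + 1) u' (((Lc ^ (n + 1 + 1) : ℕ) : ℤ) • yN a) (Sum.inl κ') (Sum.inr (μN a))
                * lamCoeffOf (KInv (N := Lc ^ (n + 1 + 1)) (d := 3)) (Lc ^ (n + 1 + 1)) ν w κ' u')
            * compLinKer (fun _ => symLinKerAt (AffineAveraging.toSite R.r) Lc) Lc k (ā.2, translate (towerTorus Lc M k) (y₀ : Site (3 + 1)) nn) (ν, w)) := by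
        simp only [scaleK_apply, Sum.elim_inl, Sum.elim_inr, one_mul, mul_comm _ t⁻¹, mul_assoc, tsum_mul_left, ← Finset.mul_sum]
      rw [e, Pi.smul_apply, smul_eq_mul, ← mul_assoc, mul_right_comm t, mul_inv_cancel₀ ht, one_mul]
    · rfl

end Storeys

end Summit.QuantumFields.BalabanUV.Beta.FP.TowerSigmaLegLetters

end
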